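import Literature.NumberTheory.EllipticCurves.HeegnerGeomShiftPinningProofs
import HarnessLib

/-!
# The point identity (P3) `z_j = a • u_j + b • v_j`, `p ∤ a`: Howard's family through the CGLS points
# (Howard 2004 §3.3; CGLS 2022 Rem. 4.1.4; Perrin-Riou 1987 §3.3) — THEOREMS ONLY

Topic `NumberTheory/EllipticCurves`; namespace `Literature.NumberTheory.EllipticCurves`. No definition, no
named fact. Cell `pub/bsd-print-x9`, LEAD `bsd-line-x9-p1` (envelope infrastructure, part VI-c).

For Howard's family `F` (`z_j = Σ_{r ∈ R_j} r • x_{j+1}`, `exists_heegnerFamily_of_system`) and the CGLS datum `C`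
(`u_k = Σ_{a ∈ A_k} a • x_{d(k)}`, `v_k = Σ_{a ∈ A_k} a • x_{d(k)−1}`, `exists_stabilizedHeegnerData_of_system`) on ONE
principal system `x_c` at the curve's own level, under `K_k ⊆ K[p^{k+1}]` and `[K[p] : K[1]] = p − 1` only (NO
pin on `d(k)` needed: `2 ≤ d(j) ≤ j + 1`):

* `exists_sum_transversal_smul_eq_zsmul_add_zsmul` — the ITERATED vertical distribution relations: the norm of
  `x_{e+1+n}` from `K[p^{e+1+n}]` to `K[p^{e+1}]` is `a • x_{e+1} + b • x_e`, `a, b ∈ ℤ`, `a ≡ a_p^n (mod p)`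
  (`S_{c+2} = a_p S_{c+1} − p S_c`; two-step induction over the tree's one-step relations);
* (P3) `HeegnerFamily.exists_z_eq_zsmul_u_add_zsmul_v_of_presentation`: for `j > δ`,
  `z_j = a • u_j + b • v_j` with `p ∤ a` at a good ORDINARY `p` (`a ≡ a_p^{j+1−d(j)}`), by decomposing `R_j`
  through `Gal(K̄/K[p^{d(j)}])`.

## References

* [CastellaGrossiLeeSkinner2022] F. Castella, G. Grossi, J. Lee, C. Skinner, *On the anticyclotomic Iwasawa
  theory of rational elliptic curves at Eisenstein primes*, Invent. Math. 227 (2022), Thm. 4.1.1 (proof: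
  `d(k)`, `P_k[n]`) and Rem. 4.1.4 (arXiv:2008.02571v2, p. 22).
* [Howard2004HeegnerKolyvagin] B. Howard, *The Heegner point Kolyvagin system*, Compos. Math. 140 (2004), §3.3.
* [PerrinRiou1987BSMF] B. Perrin-Riou, *Fonctions L p-adiques, théorie d'Iwasawa et points de Heegner*,
  Bull. SMF 115 (1987), §1 (the tower `K_∞ ⊂ ∪ K[p^n]`), §3.3 (relations de distribution).
* [Cox2013] D. A. Cox, *Primes of the form x² + ny²*, 2nd ed. (2013), Thm. 7.24, Cor. 7.28.
-/

set_option autoImplicit false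

noncomputable section

open scoped Classical

namespace Literature.NumberTheory.EllipticCurves

open WeierstrassCurve RingClassField ModularForms

variable {K : Type} [Field K] [NumberField K] {p : ℕ} [Fact p.Prime]

/-! ### §1 A transversal of `H` in `H` -/

section Transversal

variable {Γ : Type*} [Group Γ]

/-- **A transversal sum over a transversal of `H` in `H` itself is one term**: `∑_{r ∈ R} r • x = x` for `x`
fixed by `H`. [folklore] -/
private theorem sum_smul_eq_self_of_transversal_self {M : Type*} [AddCommMonoid M] [DistribMulAction Γ M]
    {H : Subgroup Γ} {R : Finset Γ} (hR : ∀ r ∈ R, r ∈ H) (htR : ∀ τ ∈ H, ∃! r, r ∈ R ∧ r⁻¹ * τ ∈ H)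
    {x : M} (hx : ∀ σ ∈ H, σ • x = x) : ∑ r ∈ R, r • x = x := by
  have h1 : ∀ r ∈ ({1} : Finset Γ), r ∈ H := by simp [H.one_mem]
  have ht1 : ∀ τ ∈ H, ∃! r, r ∈ ({1} : Finset Γ) ∧ r⁻¹ * τ ∈ H := fun τ hτ ↦
    ⟨1, ⟨Finset.mem_singleton_self 1, by simpa using hτ⟩, fun r hr ↦ Finset.mem_singleton.mp hr.1⟩
  rw [sum_smul_eq_of_transversal hR h1 htR ht1 hx, Finset.sum_singleton, one_smul]

end Transversal

/-! ### §2 The point identity (P3): Howard's `z_j` through the CGLS points `u_j`, `v_j` -/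

/-- **Iterated vertical distribution relations** (Perrin-Riou 1987 §3.3; Howard 2004 §3.3): for the principal
system `x_c` at the curve's own level, a good prime `p ∤ N_E`, `e ≥ 1` and `n ≥ 0`, the norm of `x_{e+1+n}`
from `K[p^{e+1+n}]` to `K[p^{e+1}]` is `a • x_{e+1} + b • x_e` with `a, b ∈ ℤ` and `a ≡ a_p^n (mod p)`
(`S_{c+2} = a_p S_{c+1} − p S_c`, `S_{e+1} = x_{e+1}`, `S_{e+2} = a_p x_{e+1} − x_e`).
[cite: PerrinRiou1987BSMF, §3.3 (relations de distribution)] [cite: Howard2004HeegnerKolyvagin, §3.3] -/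
theorem exists_sum_transversal_smul_eq_zsmul_add_zsmul {W : WeierstrassCurve ℚ} [W.IsElliptic]
    [W.IsGloballyMinimal] [NeZero (W.conductorNorm ℤ)] (hK : IsImaginaryQuadratic K)
    (hH : SatisfiesHeegnerHypothesis (W.conductorNorm ℤ) K)
    (Dt : ModularParametrizationData W (W.conductorNorm ℤ)) {β : ℤ}
    (hβ : (4 * (W.conductorNorm ℤ : ℕ) : ℤ) ∣ β ^ 2 - NumberField.discr K) (jbar : AlgebraicClosure K →+* ℂ)
    (hpN : ¬ p ∣ W.conductorNorm ℤ)
    {x : ℕ → WeierstrassCurve.geomPoints (W.baseChange K)}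
    {P : ∀ c : ℕ,
      (W.baseChange (ringClassField K (jbar.comp (algebraMap K (AlgebraicClosure K))) (p ^ c))).toAffine.Point}
    (hx : ∀ c, complexPoint W jbar (x c) = heegnerPointComplexOfConductor Dt (NumberField.discr K) β (p ^ c) ∧
      WeierstrassCurve.Affine.Point.map (W' := W)
        (ringClassField K (jbar.comp (algebraMap K (AlgebraicClosure K))) (p ^ c)).subtype.toRatAlgHom (P c) =
        heegnerPointComplexOfConductor Dt (NumberField.discr K) β (p ^ c) ∧
      IsHeegnerGeomPoint (W.conductorNorm ℤ) W K Dt β (p ^ c) jbar (x c) ∧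
      ∀ σ ∈ ringClassSubgroup K (p ^ c) jbar, σ • x c = x c)
    {e : ℕ} (he : 1 ≤ e) (n c : ℕ) (hc : c = e + 1 + n) {S : Finset (Field.absoluteGaloisGroup K)}
    (hS : ∀ s ∈ S, s ∈ ringClassSubgroup K (p ^ (e + 1)) jbar)
    (htS : ∀ τ ∈ ringClassSubgroup K (p ^ (e + 1)) jbar, ∃! s, s ∈ S ∧ s⁻¹ * τ ∈ ringClassSubgroup K (p ^ c) jbar) :
    ∃ a b : ℤ, (a : ZMod p) = ((W.frobeniusTrace p : ℤ) : ZMod p) ^ n ∧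
      ∑ s ∈ S, s • x c = a • x (e + 1) + b • x e := by
  have hp : p.Prime := Fact.out
  -- two-step induction on `n`
  have key : ∀ n : ℕ, (∀ c, c = e + 1 + n → ∀ S : Finset (Field.absoluteGaloisGroup K),
      (∀ s ∈ S, s ∈ ringClassSubgroup K (p ^ (e + 1)) jbar) →
      (∀ τ ∈ ringClassSubgroup K (p ^ (e + 1)) jbar, ∃! s, s ∈ S ∧ s⁻¹ * τ ∈ ringClassSubgroup K (p ^ c) jbar) →
      ∃ a b : ℤ, (a : ZMod p) = ((W.frobeniusTrace p : ℤ) : ZMod p) ^ n ∧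
        ∑ s ∈ S, s • x c = a • x (e + 1) + b • x e) ∧
    (∀ c, c = e + 1 + (n + 1) → ∀ S : Finset (Field.absoluteGaloisGroup K),
      (∀ s ∈ S, s ∈ ringClassSubgroup K (p ^ (e + 1)) jbar) →
      (∀ τ ∈ ringClassSubgroup K (p ^ (e + 1)) jbar, ∃! s, s ∈ S ∧ s⁻¹ * τ ∈ ringClassSubgroup K (p ^ c) jbar) →
      ∃ a b : ℤ, (a : ZMod p) = ((W.frobeniusTrace p : ℤ) : ZMod p) ^ (n + 1) ∧
        ∑ s ∈ S, s • x c = a • x (e + 1) + b • x e) := by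
    intro n
    induction n with
    | zero =>
      constructor
      · rintro c rfl S hS htS
        refine ⟨1, 0, by simp, ?_⟩
        rw [Nat.add_zero] at htS ⊢
        rw [sum_smul_eq_self_of_transversal_self hS htS (hx (e + 1)).2.2.2, one_smul, zero_smul, add_zero]
      · rintro c rfl S hS htS
        refine ⟨W.frobeniusTrace p, -1, by simp, ?_⟩
        have h := sum_transversal_smul_eq_frobeniusTrace_smul_sub hK hH Dt hβ jbar hp hpN e (hx e).1
          (hx (e + 1)).1 ((hx (e + 2)).1.trans (hx (e + 2)).2.1.symm) (hx (e + 2)).2.1 hS htS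
        rw [show e + 1 + (0 + 1) = e + 2 from rfl, h, neg_smul, one_smul, sub_eq_add_neg]
    | succ n ih =>
      refine ⟨ih.2, ?_⟩
      rintro c rfl S hS htS
      -- transversals of the two intermediate steps inside `Gal(K̄/K[p^{e+1}])`
      haveI := finiteIndex_ringClassSubgroup K (p ^ (e + 1 + n)) jbar
      haveI := finiteIndex_ringClassSubgroup K (p ^ (e + 1 + n + 1)) jbar
      obtain ⟨A₀, hA₀, htA₀⟩ := exists_finset_transversal' (ringClassSubgroup K (p ^ (e + 1 + n)) jbar)
        (ringClassSubgroup K (p ^ (e + 1)) jbar)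
      obtain ⟨A₁, hA₁, htA₁⟩ := exists_finset_transversal' (ringClassSubgroup K (p ^ (e + 1 + n + 1)) jbar)
        (ringClassSubgroup K (p ^ (e + 1)) jbar)
      obtain ⟨a₀, b₀, ha₀, h₀⟩ := ih.1 (e + 1 + n) rfl A₀ hA₀ htA₀
      obtain ⟨a₁, b₁, ha₁, h₁⟩ := ih.2 (e + 1 + n + 1) rfl A₁ hA₁ htA₁
      have hΛ : ringClassSubgroup K (p ^ (e + 1 + n)) jbar ≤ ringClassSubgroup K (p ^ (e + 1)) jbar :=
        ringClassSubgroup_anti hK jbar (pow_dvd_pow p (by omega)) (pow_ne_zero _ hp.ne_zero)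
      have htS' : ∀ τ ∈ ringClassSubgroup K (p ^ (e + 1)) jbar,
          ∃! s, s ∈ S ∧ s⁻¹ * τ ∈ ringClassSubgroup K (p ^ (e + 1 + n + 2)) jbar := by
        simpa only [show e + 1 + (n + 1 + 1) = e + 1 + n + 2 by omega] using htS
      have h := sum_transversal_smul_eq_frobeniusTrace_smul_sub_prime_smul hK hH Dt hβ jbar hp hpN
        (e := e + 1 + n) (by omega) (hx (e + 1 + n)).1 (hx (e + 1 + n)).2.2.2 (hx (e + 1 + n + 1)).1
        ((hx (e + 1 + n + 2)).1.trans (hx (e + 1 + n + 2)).2.1.symm) (hx (e + 1 + n + 2)).2.1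
        (hx (e + 1 + n + 2)).2.2.2 hΛ hA₀ htA₀ hA₁ htA₁ hS htS'
      refine ⟨W.frobeniusTrace p * a₁ - p * a₀, W.frobeniusTrace p * b₁ - p * b₀, ?_, ?_⟩
      · push_cast
        rw [ha₁, ZMod.natCast_self, zero_mul, sub_zero]
        ring
      · rw [show e + 1 + (n + 1 + 1) = e + 1 + n + 2 by omega, h, h₁, h₀]
        module
  exact (key n).1 c hc S hS htS

/-- **(P3) `z_j = a • u_j + b • v_j` with `p ∤ a`, for `j > δ`** (Howard 2004 §3.3 / CGLS 2022 Rem. 4.1.4: the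
family's norm point of conductor `p^{j+1}` versus the `d(j)`-shifted points, `d(j) ≤ j + 1`; the leading
coefficient is `≡ a_p^{j+1−d(j)} (mod p)`, a unit at a good ORDINARY `p`): for Howard's family `F` with
`z_j = Σ_{r ∈ R_j} r • x_{j+1}` and the CGLS datum `C` with `u_k = Σ_{a ∈ A_k} a • x_{d(k)}`, `v_k = Σ_{a ∈ A_k}
a • x_{d(k)−1}` on ONE principal system (the outputs of `exists_heegnerFamily_of_system` /
`exists_stabilizedHeegnerData_of_system`), `K_k ⊆ K[p^{k+1}]` and `[K[p] : K[1]] = p − 1`.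
[cite: Howard2004HeegnerKolyvagin, §3.3 (H_k and the norm points)] [cite: CastellaGrossiLeeSkinner2022, Rem. 4.1.4 (arXiv:2008.02571v2 p. 22)]
[cite: PerrinRiou1987BSMF, §3.3 (relations de distribution)] -/
theorem HeegnerFamily.exists_z_eq_zsmul_u_add_zsmul_v_of_presentation {W : WeierstrassCurve ℚ} [W.IsElliptic]
    [W.IsGloballyMinimal] [NeZero (W.conductorNorm ℤ)] {κ : ZpExtension K p} {jbar : AlgebraicClosure K →+* ℂ}
    (F : HeegnerFamily (W.conductorNorm ℤ) W K κ jbar)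
    (C : CastellaGrossiLeeSkinner2022.StabilizedHeegnerData (W.conductorNorm ℤ) W K κ jbar)
    (hK : IsImaginaryQuadratic K) (hH : SatisfiesHeegnerHypothesis (W.conductorNorm ℤ) K)
    (Dt : ModularParametrizationData W (W.conductorNorm ℤ)) {β : ℤ}
    (hβ : (4 * (W.conductorNorm ℤ : ℕ) : ℤ) ∣ β ^ 2 - NumberField.discr K) (hpN : ¬ p ∣ W.conductorNorm ℤ)
    (hord : ¬ (p : ℤ) ∣ W.frobeniusTrace p)
    (hTw1 : ∀ k, ringClassSubgroup K (p ^ (k + 1)) jbar ≤ κ.layerSubgroup k)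
    (hcardp : Nat.card (ringClassGalOver (jbar.comp (algebraMap K (AlgebraicClosure K))) p 1) = p - 1)
    {x : ℕ → WeierstrassCurve.geomPoints (W.baseChange K)}
    {P : ∀ c : ℕ,
      (W.baseChange (ringClassField K (jbar.comp (algebraMap K (AlgebraicClosure K))) (p ^ c))).toAffine.Point}
    (hx : ∀ c, complexPoint W jbar (x c) = heegnerPointComplexOfConductor Dt (NumberField.discr K) β (p ^ c) ∧
      WeierstrassCurve.Affine.Point.map (W' := W)
        (ringClassField K (jbar.comp (algebraMap K (AlgebraicClosure K))) (p ^ c)).subtype.toRatAlgHom (P c) =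
        heegnerPointComplexOfConductor Dt (NumberField.discr K) β (p ^ c) ∧
      IsHeegnerGeomPoint (W.conductorNorm ℤ) W K Dt β (p ^ c) jbar (x c) ∧
      ∀ σ ∈ ringClassSubgroup K (p ^ c) jbar, σ • x c = x c)
    {A : ℕ → Finset (Field.absoluteGaloisGroup K)}
    (hA : ∀ k, (∀ a ∈ A k, a ∈ κ.layerSubgroup k) ∧
      ∀ τ ∈ κ.layerSubgroup k, ∃! a, a ∈ A k ∧ a⁻¹ * τ ∈ ringClassSubgroup K (p ^ C.d k) jbar)
    (hu : ∀ k, C.u k = ∑ a ∈ A k, a • x (C.d k)) (hv : ∀ k, C.v k = ∑ a ∈ A k, a • x (C.d k - 1))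
    {R : ℕ → Finset (Field.absoluteGaloisGroup K)}
    (hR : ∀ j, (∀ r ∈ R j, r ∈ κ.layerSubgroup j) ∧
      ∀ τ ∈ κ.layerSubgroup j, ∃! r, r ∈ R j ∧ r⁻¹ * τ ∈ ringClassSubgroup K (p ^ (j + 1)) jbar)
    (hz : ∀ j, F.z j = ∑ r ∈ R j, r • x (j + 1)) {j : ℕ} (hj : C.depth < j) :
    ∃ a b : ℤ, ¬ (p : ℤ) ∣ a ∧ F.z j = a • C.u j + b • C.v j := by
  have hp : p.Prime := Fact.out
  have hd2 : 2 ≤ C.d j := C.two_le_d hK hcardp hj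
  have hdle : C.d j ≤ j + 1 := C.d_le_succ hTw1 j
  obtain ⟨e, he⟩ : ∃ e, C.d j = e + 1 := ⟨C.d j - 1, by omega⟩
  -- decompose `R_j` through `Gal(K̄/K[p^{d(j)}])`
  haveI := finiteIndex_ringClassSubgroup K (p ^ (j + 1)) jbar
  obtain ⟨S, hS, htS⟩ := exists_finset_transversal' (ringClassSubgroup K (p ^ (j + 1)) jbar)
    (ringClassSubgroup K (p ^ (e + 1)) jbar)
  have hHM : ringClassSubgroup K (p ^ (j + 1)) jbar ≤ ringClassSubgroup K (p ^ (e + 1)) jbar :=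
    ringClassSubgroup_anti hK jbar (pow_dvd_pow p (by omega)) (pow_ne_zero _ hp.ne_zero)
  have hML : ringClassSubgroup K (p ^ (e + 1)) jbar ≤ κ.layerSubgroup j := by rw [← he]; exact C.layer_le j
  have htAj : ∀ τ ∈ κ.layerSubgroup j, ∃! a, a ∈ A j ∧ a⁻¹ * τ ∈ ringClassSubgroup K (p ^ (e + 1)) jbar := by
    have := (hA j).2
    rwa [he] at this
  have hdecomp := sum_smul_eq_sum_sum_smul hHM hML (hA j).1 htAj hS htS (hR j).1 (hR j).2 (hx (j + 1)).2.2.2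
  -- the inner norm from `K[p^{j+1}]` to `K[p^{e+1}]`
  obtain ⟨a, b, ha, hab⟩ := exists_sum_transversal_smul_eq_zsmul_add_zsmul hK hH Dt hβ jbar hpN hx
    (e := e) (by omega) (j - e) (j + 1) (by omega) hS htS
  refine ⟨a, b, ?_, ?_⟩
  · -- `a ≡ a_p^{j-e} (mod p)` is a unit mod `p`
    intro hpa
    have h0 : (a : ZMod p) = 0 := (ZMod.intCast_zmod_eq_zero_iff_dvd a p).mpr hpa
    rw [ha] at h0
    have h1 : ((W.frobeniusTrace p : ℤ) : ZMod p) = 0 := pow_eq_zero_iff'.mp h0 |>.1 |> fun h ↦ by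
      rcases Nat.eq_zero_or_pos (j - e) with hn | hn
      · rw [hn, pow_zero] at h0; exact absurd h0 one_ne_zero
      · exact (pow_eq_zero_iff hn.ne').mp h0
    exact hord ((ZMod.intCast_zmod_eq_zero_iff_dvd _ p).mp h1)
  · rw [hz j, hdecomp, hab, hu j, hv j, he, Nat.add_sub_cancel, Finset.smul_sum, Finset.smul_sum,
      ← Finset.sum_add_distrib]
    refine Finset.sum_congr rfl fun g _ ↦ ?_
    rw [smul_add]
    congr 1
    · exact (map_zsmul (DistribSMul.toAddMonoidHom _ g) a (x (e + 1)))
    · exact (map_zsmul (DistribSMul.toAddMonoidHom _ g) b (x e))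

end Literature.NumberTheory.EllipticCurves

end
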